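import Literature.Probability.Distributions.BrascampLieb
import Literature.Analysis.OperatorTheory.SobolevPointBound
import Literature.NumberTheory.DiophantineGeometry.MahlerMeasureSeveral
import HarnessLib

/-!
# Calculus glue for the Brascamp–Lieb induction: coordinates, fibers, Fubini

`Literature/Probability/Distributions/`. Bookkeeping lemmas for the proof of Brascamp–Lieb 1976,
Theorem 4.1 (`BrascampLieb1976_thm41`), relating the coordinate objects of the statement
(`coordGradient`, `coordHessian`, functions on `Fin n → ℝ`) to Mathlib's Fréchet derivatives, and
splitting `ℝⁿ⁺¹ ∋ x = (y, z)`, `y ∈ ℝ`, `z ∈ ℝⁿ` via `Fin.cons`: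

* `coordHessian f x i j = D²f(x)(eᵢ)(eⱼ)` and `⟨v, f_xx w⟩ = D²f(x)(v)(w)` for `f ∈ C²`;
  symmetry of `f_xx`;
* derivatives of `y ↦ Fin.cons y z` and `z ↦ Fin.cons y z`; gradient and Hessian of the fiber
  restriction `z ↦ f (Fin.cons y z)` (a sub-vector, resp. the `z`-block, of those of `f`);
* sup-norm estimates for `Fin.cons y z`;
* Fubini/Tonelli along the first coordinate for Lebesgue measure on `Fin (n+1) → ℝ`.

Theorems only; the embedding `consZeroL : z ↦ Fin.cons 0 z`, `cons_zero_single` and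
`norm_le_norm_cons` are reused from `Literature.Analysis.OperatorTheory` (`SobolevPointBound`), and
`piFinSuccAbove_symm_apply'` from `Literature.NumberTheory.DiophantineGeometry`
(`MahlerMeasureSeveral`). References: H. J. Brascamp, E. H. Lieb, J. Funct. Anal. 22 (1976) 366–389, §4
(notation (4.1)–(4.4)). [BrascampLieb1976]
-/

noncomputable section

open MeasureTheory Filter Set Matrix
open Literature.Analysis.OperatorTheory (consZeroL consZeroL_apply cons_eq_add cons_zero_single
  norm_le_norm_cons)
open Literature.NumberTheory.DiophantineGeometry (piFinSuccAbove_symm_apply')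
open scoped ENNReal Topology

namespace Literature.Probability.Distributions

namespace BrascampLiebCalculus

variable {n : ℕ}

/-! ### `Fin.cons` as an affine map; norms -/

/-- `z ↦ Fin.cons y z` has derivative `w ↦ Fin.cons 0 w = consZeroL w`. [folklore] -/
theorem hasFDerivAt_cons_right (y : ℝ) (z : Fin n → ℝ) :
    HasFDerivAt (fun w : Fin n → ℝ => (Fin.cons y w : Fin (n + 1) → ℝ)) consZeroL z := by
  have e : (fun w : Fin n → ℝ => (Fin.cons y w : Fin (n + 1) → ℝ)) =
      fun w => Fin.cons y (0 : Fin n → ℝ) + consZeroL w := by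
    funext w
    exact cons_eq_add y w
  rw [e]
  exact (consZeroL.hasFDerivAt).const_add _

/-- `Fin.cons 1 0 = e₀`. [folklore] -/
theorem cons_one_zero : (Fin.cons 1 0 : Fin (n + 1) → ℝ) = Pi.single 0 1 := by
  ext i
  refine Fin.cases ?_ (fun j => ?_) i
  · simp
  · simp [Fin.succ_ne_zero]

/-- `y ↦ Fin.cons y z` has derivative `e₀`. [folklore] -/
theorem hasDerivAt_cons_left (z : Fin n → ℝ) (y : ℝ) :
    HasDerivAt (fun s : ℝ => (Fin.cons s z : Fin (n + 1) → ℝ)) (Pi.single 0 1) y := by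
  rw [hasDerivAt_pi]
  intro i
  refine Fin.cases ?_ (fun j => ?_) i
  · simp only [Fin.cons_zero, Pi.single_eq_same]
    exact hasDerivAt_id' y
  · simpa [Fin.succ_ne_zero] using hasDerivAt_const y (z j)

/-- `|y| ≤ ‖Fin.cons y z‖`. [folklore] -/
theorem abs_le_norm_cons (y : ℝ) (z : Fin n → ℝ) : |y| ≤ ‖(Fin.cons y z : Fin (n + 1) → ℝ)‖ := by
  have := norm_le_pi_norm (Fin.cons y z : Fin (n + 1) → ℝ) 0
  simpa using this

/-- `‖Fin.cons y z‖ ≤ |y| + ‖z‖`. [folklore] -/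
theorem norm_cons_le (y : ℝ) (z : Fin n → ℝ) : ‖(Fin.cons y z : Fin (n + 1) → ℝ)‖ ≤ |y| + ‖z‖ := by
  refine (pi_norm_le_iff_of_nonneg (by positivity)).2 fun i => ?_
  refine Fin.cases ?_ (fun j => ?_) i
  · simp
  · have := norm_le_pi_norm z j
    simp only [Fin.cons_succ]
    linarith [abs_nonneg y]

/-- `‖Fin.cons 0 z‖ = ‖z‖`. [folklore] -/
theorem norm_cons_zero (z : Fin n → ℝ) : ‖(Fin.cons 0 z : Fin (n + 1) → ℝ)‖ = ‖z‖ := by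
  refine le_antisymm ?_ (norm_le_norm_cons 0 z)
  have := norm_cons_le 0 z
  simpa using this

/-- `1 + ‖Fin.cons y z‖ ≤ (1 + |y|) (1 + ‖z‖)`. [folklore] -/
theorem one_add_norm_cons_le (y : ℝ) (z : Fin n → ℝ) :
    1 + ‖(Fin.cons y z : Fin (n + 1) → ℝ)‖ ≤ (1 + |y|) * (1 + ‖z‖) := by
  have := norm_cons_le y z
  nlinarith [abs_nonneg y, norm_nonneg z]

/-! ### The Hessian matrix and the second Fréchet derivative -/

variable {m : ℕ}

/-- For `f ∈ C²`, `x ↦ Df(x) v` is `C¹` with derivative `w ↦ D²f(x)(w)(v)`. [folklore] -/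
theorem hasFDerivAt_fderiv_apply {f : (Fin m → ℝ) → ℝ} (hf : ContDiff ℝ 2 f) (x v : Fin m → ℝ) :
    HasFDerivAt (fun x' => fderiv ℝ f x' v) ((fderiv ℝ (fderiv ℝ f) x).flip v) x := by
  have hd : DifferentiableAt ℝ (fderiv ℝ f) x :=
    ((hf.fderiv_right (m := 1) le_rfl).differentiable one_ne_zero).differentiableAt
  have := hd.hasFDerivAt.clm_apply (hasFDerivAt_const v x)
  simpa using this

/-- Entries of the Hessian matrix: `(f_xx)ᵢⱼ = D²f(x)(eᵢ)(eⱼ)`. [folklore] -/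
theorem coordHessian_apply {f : (Fin m → ℝ) → ℝ} (hf : ContDiff ℝ 2 f) (x : Fin m → ℝ) (i j : Fin m) :
    coordHessian f x i j = fderiv ℝ (fderiv ℝ f) x (Pi.single i 1) (Pi.single j 1) := by
  simp only [coordHessian, Matrix.of_apply]
  rw [(hasFDerivAt_fderiv_apply hf x (Pi.single j 1)).fderiv]
  rfl

/-- The quadratic form of the Hessian matrix is the second derivative:
`⟨v, f_xx w⟩ = D²f(x)(v)(w)`. [folklore] -/
theorem dotProduct_coordHessian_mulVec {f : (Fin m → ℝ) → ℝ} (hf : ContDiff ℝ 2 f)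
    (x v w : Fin m → ℝ) :
    v ⬝ᵥ (coordHessian f x *ᵥ w) = fderiv ℝ (fderiv ℝ f) x v w := by
  set B := fderiv ℝ (fderiv ℝ f) x with hB
  have hv : v = ∑ i, v i • (Pi.single i (1 : ℝ) : Fin m → ℝ) := by
    conv_lhs => rw [← Finset.univ_sum_single v]
    refine Finset.sum_congr rfl fun i _ => ?_
    rw [← Pi.single_smul, smul_eq_mul, mul_one]
  have hw : w = ∑ j, w j • (Pi.single j (1 : ℝ) : Fin m → ℝ) := by
    conv_lhs => rw [← Finset.univ_sum_single w]
    refine Finset.sum_congr rfl fun j _ => ?_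
    rw [← Pi.single_smul, smul_eq_mul, mul_one]
  have h1 : B v = ∑ i, v i • B (Pi.single i 1) := by
    conv_lhs => rw [hv]
    simp only [map_sum, map_smul]
  have h2 : ∀ i, B (Pi.single i 1) w = ∑ j, w j * B (Pi.single i 1) (Pi.single j 1) := by
    intro i
    conv_lhs => rw [hw]
    simp only [map_sum, map_smul, smul_eq_mul]
  have key : B v w = ∑ i, ∑ j, v i * w j * B (Pi.single i 1) (Pi.single j 1) := by
    rw [h1, FunLike.coe_sum, Finset.sum_apply]
    refine Finset.sum_congr rfl fun i _ => ?_
    rw [FunLike.coe_smul, Pi.smul_apply, h2 i, smul_eq_mul, Finset.mul_sum]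
    refine Finset.sum_congr rfl fun j _ => ?_
    ring
  rw [key]
  simp only [dotProduct, mulVec, coordHessian_apply hf, Finset.mul_sum]
  refine Finset.sum_congr rfl fun i _ => Finset.sum_congr rfl fun j _ => ?_
  ring

/-- The Hessian matrix of a `C²` function is symmetric. [folklore] -/
theorem coordHessian_transpose {f : (Fin m → ℝ) → ℝ} (hf : ContDiff ℝ 2 f) (x : Fin m → ℝ) :
    (coordHessian f x)ᵀ = coordHessian f x := by
  ext i j
  rw [transpose_apply, coordHessian_apply hf, coordHessian_apply hf]
  have hs : IsSymmSndFDerivAt ℝ f x :=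
    (hf.contDiffAt (x := x)).isSymmSndFDerivAt (by simp)
  exact hs _ _

/-- The Hessian matrix of a `C²` function is Hermitian (real symmetric). [folklore] -/
theorem coordHessian_isHermitian {f : (Fin m → ℝ) → ℝ} (hf : ContDiff ℝ 2 f) (x : Fin m → ℝ) :
    (coordHessian f x).IsHermitian := by
  rw [IsHermitian, conjTranspose_eq_transpose_of_trivial, coordHessian_transpose hf]

/-- Positive definiteness of the Hessian matrix in terms of the second derivative: for `f ∈ C²`,
`f_xx(x) > 0` iff `D²f(x)(v)(v) > 0` for all `v ≠ 0`. [folklore] -/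
theorem posDef_coordHessian_iff {f : (Fin m → ℝ) → ℝ} (hf : ContDiff ℝ 2 f) (x : Fin m → ℝ) :
    (coordHessian f x).PosDef ↔ ∀ v : Fin m → ℝ, v ≠ 0 → 0 < fderiv ℝ (fderiv ℝ f) x v v := by
  rw [posDef_iff_dotProduct_mulVec]
  constructor
  · rintro ⟨-, h⟩ v hv
    have := h hv
    simpa [dotProduct_coordHessian_mulVec hf] using this
  · intro h
    refine ⟨coordHessian_isHermitian hf x, fun v hv => ?_⟩
    simpa [dotProduct_coordHessian_mulVec hf] using h v hv

/-- The continuity of `x ↦ f_xx(x)` for `f ∈ C²`. [folklore] -/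
theorem continuous_coordHessian {f : (Fin m → ℝ) → ℝ} (hf : ContDiff ℝ 2 f) :
    Continuous fun x => coordHessian f x := by
  refine continuous_matrix fun i j => ?_
  simp_rw [coordHessian_apply hf]
  have hc : Continuous (fderiv ℝ (fderiv ℝ f)) :=
    (hf.fderiv_right (m := 1) le_rfl).continuous_fderiv one_ne_zero
  fun_prop

/-- The continuity of `x ↦ ∇h(x)` for `h ∈ C¹`. [folklore] -/
theorem continuous_coordGradient {h : (Fin m → ℝ) → ℝ} (hh : ContDiff ℝ 1 h) :
    Continuous fun x => coordGradient h x := by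
  refine continuous_pi fun i => ?_
  simp only [coordGradient]
  have hc : Continuous (fderiv ℝ h) := hh.continuous_fderiv one_ne_zero
  fun_prop

/-! ### Derivatives along lines -/

/-- `s ↦ f (x + s v)` has derivative `Df(x + s v) v`. [folklore] -/
theorem hasDerivAt_line {f : (Fin m → ℝ) → ℝ} (hf : Differentiable ℝ f) (x v : Fin m → ℝ) (s : ℝ) :
    HasDerivAt (fun s : ℝ => f (x + s • v)) (fderiv ℝ f (x + s • v) v) s := by
  have hl : HasDerivAt (fun s : ℝ => x + s • v) v s := by
    simpa using ((hasDerivAt_id s).smul_const v).const_add x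
  exact (hf (x + s • v)).hasFDerivAt.comp_hasDerivAt s hl

/-- `s ↦ Df(x + s v) v` has derivative `D²f(x + s v) v v` for `f ∈ C²`. [folklore] -/
theorem hasDerivAt_line_fderiv {f : (Fin m → ℝ) → ℝ} (hf : ContDiff ℝ 2 f) (x v : Fin m → ℝ) (s : ℝ) :
    HasDerivAt (fun s : ℝ => fderiv ℝ f (x + s • v) v)
      (fderiv ℝ (fderiv ℝ f) (x + s • v) v v) s := by
  have hl : HasDerivAt (fun s : ℝ => x + s • v) v s := by
    simpa using ((hasDerivAt_id s).smul_const v).const_add x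
  have := (hasFDerivAt_fderiv_apply hf (x + s • v) v).comp_hasDerivAt s hl
  exact this

/-! ### Fibers `z ↦ f (y, z)` -/

/-- Derivative of the fiber restriction: `D(f ∘ cons y)(z) w = Df(cons y z)(cons 0 w)`. [folklore] -/
theorem hasFDerivAt_fiber {f : (Fin (n + 1) → ℝ) → ℝ} (hf : Differentiable ℝ f) (y : ℝ) (z : Fin n → ℝ) :
    HasFDerivAt (fun w => f (Fin.cons y w)) ((fderiv ℝ f (Fin.cons y z)).comp consZeroL) z :=
  (hf (Fin.cons y z)).hasFDerivAt.comp z (hasFDerivAt_cons_right y z)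

/-- `D(f ∘ cons y)(z) w = Df(cons y z)(cons 0 w)`. [folklore] -/
theorem fderiv_fiber_apply {f : (Fin (n + 1) → ℝ) → ℝ} (hf : Differentiable ℝ f) (y : ℝ)
    (z w : Fin n → ℝ) :
    fderiv ℝ (fun w => f (Fin.cons y w)) z w = fderiv ℝ f (Fin.cons y z) (Fin.cons 0 w) := by
  rw [(hasFDerivAt_fiber hf y z).fderiv, ContinuousLinearMap.comp_apply, consZeroL_apply]

/-- The fiber restriction of a `C^k` function is `C^k`. [folklore] -/
theorem contDiff_fiber {f : (Fin (n + 1) → ℝ) → ℝ} {k : ℕ∞} (hf : ContDiff ℝ k f) (y : ℝ) :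
    ContDiff ℝ k fun w : Fin n → ℝ => f (Fin.cons y w) := by
  have hc : ContDiff ℝ k fun w : Fin n → ℝ => (Fin.cons y w : Fin (n + 1) → ℝ) := by
    have e : (fun w : Fin n → ℝ => (Fin.cons y w : Fin (n + 1) → ℝ)) =
        fun w => Fin.cons y (0 : Fin n → ℝ) + consZeroL w := by
      funext w; exact cons_eq_add y w
    rw [e]
    exact contDiff_const.add (consZeroL (n := n)).contDiff
  exact hf.comp hc

/-- Derivative in `y`: `d/dy f(cons y z) = Df(cons y z) e₀ = ∂₀f`. [folklore] -/
theorem hasDerivAt_fiber_left {f : (Fin (n + 1) → ℝ) → ℝ} (hf : Differentiable ℝ f) (z : Fin n → ℝ) (y : ℝ) :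
    HasDerivAt (fun s : ℝ => f (Fin.cons s z)) (fderiv ℝ f (Fin.cons y z) (Pi.single 0 1)) y :=
  (hf (Fin.cons y z)).hasFDerivAt.comp_hasDerivAt y (hasDerivAt_cons_left z y)

/-- Gradient of the fiber restriction: `∇(f ∘ cons y)(z)ⱼ = (∇f)(cons y z)_{j+1}`. [folklore] -/
theorem coordGradient_fiber {h : (Fin (n + 1) → ℝ) → ℝ} (hh : Differentiable ℝ h) (y : ℝ) (z : Fin n → ℝ) :
    coordGradient (fun w => h (Fin.cons y w)) z = fun j => coordGradient h (Fin.cons y z) j.succ := by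
  funext j
  simp only [coordGradient]
  rw [fderiv_fiber_apply hh, cons_zero_single]

/-- Hessian of the fiber restriction = the `z`-block of the Hessian. [folklore] -/
theorem coordHessian_fiber {f : (Fin (n + 1) → ℝ) → ℝ} (hf : ContDiff ℝ 2 f) (y : ℝ) (z : Fin n → ℝ) :
    coordHessian (fun w => f (Fin.cons y w)) z =
      (coordHessian f (Fin.cons y z)).submatrix Fin.succ Fin.succ := by
  have hd : Differentiable ℝ f := hf.differentiable (by simp)
  ext i j
  simp only [coordHessian, Matrix.of_apply, submatrix_apply]
  have e : (fun w : Fin n → ℝ => fderiv ℝ (fun w' => f (Fin.cons y w')) w (Pi.single j 1)) =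
      fun w => (fun x => fderiv ℝ f x (Pi.single j.succ 1)) (Fin.cons y w) := by
    funext w
    rw [fderiv_fiber_apply hd, cons_zero_single]
  rw [e]
  have hd1 : Differentiable ℝ fun x => fderiv ℝ f x (Pi.single j.succ 1) := fun x =>
    (hasFDerivAt_fderiv_apply hf x _).differentiableAt
  rw [fderiv_fiber_apply hd1, cons_zero_single]

/-! ### Fubini along the first coordinate -/

/-- The map `(y, z) ↦ Fin.cons y z` carries `volume ⊗ volume` to `volume`. [folklore] -/
theorem measurePreserving_cons :
    MeasurePreserving (fun p : ℝ × (Fin n → ℝ) => (Fin.cons p.1 p.2 : Fin (n + 1) → ℝ))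
      (volume : Measure (ℝ × (Fin n → ℝ))) volume := by
  have h := (volume_preserving_piFinSuccAbove (fun _ : Fin (n + 1) => ℝ) 0).symm
  have e : (fun p : ℝ × (Fin n → ℝ) => (Fin.cons p.1 p.2 : Fin (n + 1) → ℝ)) =
      ⇑(MeasurableEquiv.piFinSuccAbove (fun _ : Fin (n + 1) => ℝ) 0).symm := by
    funext p
    exact (piFinSuccAbove_symm_apply' p).symm
  rw [e]
  exact h

/-- **Tonelli along the first coordinate**: `∫ φ dx = ∫ dy ∫ dz φ(y, z)` on `ℝⁿ⁺¹ = ℝ × ℝⁿ`,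
extended integrals. [folklore] -/
theorem lintegral_eq_lintegral_cons {φ : (Fin (n + 1) → ℝ) → ℝ≥0∞} (hφ : Measurable φ) :
    ∫⁻ x, φ x = ∫⁻ y : ℝ, ∫⁻ z : Fin n → ℝ, φ (Fin.cons y z) := by
  rw [← measurePreserving_cons.lintegral_comp hφ,
    show (volume : Measure (ℝ × (Fin n → ℝ))) = volume.prod volume from rfl,
    lintegral_prod (fun p : ℝ × (Fin n → ℝ) => φ (Fin.cons p.1 p.2))
      (hφ.comp measurePreserving_cons.measurable).aemeasurable]

/-- Integrability transfers along `(y, z) ↦ Fin.cons y z`. [folklore] -/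
theorem integrable_cons_iff {φ : (Fin (n + 1) → ℝ) → ℝ} :
    Integrable (fun p : ℝ × (Fin n → ℝ) => φ (Fin.cons p.1 p.2)) (volume.prod volume) ↔
      Integrable φ := by
  have h := (volume_preserving_piFinSuccAbove (fun _ : Fin (n + 1) => ℝ) 0).symm
  have := h.integrable_comp_emb
    (MeasurableEquiv.piFinSuccAbove (fun _ : Fin (n + 1) => ℝ) 0).symm.measurableEmbedding (g := φ)
  rw [← this]
  simp only [Function.comp_def, piFinSuccAbove_symm_apply']
  rfl

/-- **Fubini along the first coordinate**: `∫ φ dx = ∫ dy ∫ dz φ(y, z)` for integrable `φ`.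
[folklore] -/
theorem integral_eq_integral_cons {φ : (Fin (n + 1) → ℝ) → ℝ} (hφ : Integrable φ) :
    ∫ x, φ x = ∫ y : ℝ, ∫ z : Fin n → ℝ, φ (Fin.cons y z) := by
  have h := (volume_preserving_piFinSuccAbove (fun _ : Fin (n + 1) => ℝ) 0).symm
  rw [← h.integral_comp', show (volume : Measure (ℝ × (Fin n → ℝ))) = volume.prod volume from rfl]
  simp_rw [piFinSuccAbove_symm_apply']
  exact integral_prod _ (integrable_cons_iff.2 hφ)

/-- The inner integrals `y ↦ ∫ φ(y, z) dz` of an integrable `φ` form an integrable function.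
[folklore] -/
theorem integrable_integral_cons {φ : (Fin (n + 1) → ℝ) → ℝ} (hφ : Integrable φ) :
    Integrable fun y : ℝ => ∫ z : Fin n → ℝ, φ (Fin.cons y z) :=
  (integrable_cons_iff.2 hφ).integral_prod_left

end BrascampLiebCalculus

end Literature.Probability.Distributions
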